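import Summits.BirchSwinnertonDyer.BirchSwinnertonDyer.Theorems.ByReductionTypeAtTwoMultTransportRealTorsion
import Literature.NumberTheory.EllipticCurves.LambdaInvariantCongruenceTransportAtTwo
import Literature.NumberTheory.EllipticCurves.KummerMap
import HarnessLib

/-!
# T-42-mult in the kernel, IV-a: the Klein four-group `E[2](ℚ̄)` of a curve with exactly one rational
# point of order `2` — enumeration, Galois dévissage, and isomorphisms with prescribed values

Cell `bsd-2adic` (run/shared/lean/pub/bsd-2adic/), seat `bsd-2adic-t42` (BRIEF-T42, DESIGN-T42 §3.6 / §5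
item K-res, first half): elementary group theory of groups of order `4` and exponent `2`, and the
rational point of order `2` inside `E[2](ℚ̄)`. HONEST FRAMING: research route; theorems only (no `def`, no
named fact, nothing booked).

WHAT THIS FILE PROVES.
* §1 (Klein four-groups; any additive group `M` with `#M = 4` and `m + m = 0`): `klein_cases` (for
  `a ≠ b` non-zero, every element is `0, a, b` or `a + b`), `klein_addMonoidHom_ext` (additive maps
  agreeing on `a, b` are equal), **`klein_exists_addEquiv`** (for such pairs `a, b ∈ M`, `a', b' ∈ N`
  there is `θ : M ≃+ N` with `θ a = a'`, `θ b = b'`).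
* §2 (the rational point): coordinate helpers on `E(ℚ̄)` (`smul_geomPoints_of_eq_some`,
  `some_eq_some_geomPoints`, `add_self_eq_zero_geomPoints_of_eq_some`, `two_torsion_coords_geomPoints`:
  a point `(X, Y)` has order `2` iff `2Y + a₁X + a₃ = 0`, and then `X` is a root of
  `4T³ + b₂T² + 2b₄T + b₆`); for `E/ℚ` with a rational point `P = (x, y)` of order `2`
  (`HasRationalTwoTorsionX W x`): **`exists_geomTorsion_two_of_hasRationalTwoTorsionX`** — the point
  `P ∈ E[2](ℚ̄)`, non-zero and `Γ_ℚ`-fixed, with coordinates `(x, y)`; **`eq_zero_or_eq_of_smul_eq`** —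
  if `P` is the ONLY rational point of order `2` (`HasUniqueRationalTwoTorsionX W x`) then every
  `Γ_ℚ`-fixed `T ∈ E[2](ℚ̄)` is `0` or `P` (Galois descent `exists_toGeomPoints_eq_of_forall_smul_eq`);
  **`smul_eq_self_or_eq_add`** — the dévissage `σ • T ∈ {T, T + P}` for every `σ ∈ Γ_ℚ`
  (tree `sub_mem_pair_of_natCard_le_four`).

References: [SilvermanAEC2009] III.2.3, VIII.1, X.4 Ex. 4.8–Prop. 4.9; [GreenbergLNM1716] §5 p. 168
(the three lines of `E[2]`); [Matsuno2008] p. 415 (the residual isomorphism `φ`).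
-/

set_option autoImplicit false

set_option linter.dupNamespace false

noncomputable section

open scoped Classical

universe u

namespace Summit.BirchSwinnertonDyer.BirchSwinnertonDyer.Theorems.MultTransportAtTwo

open Field Literature.NumberTheory.EllipticCurves Literature.NumberTheory.EllipticCurves.Greenberg1999
  WeierstrassCurve

/-! ## §1. Klein four-groups -/

section Klein

variable {M : Type*} [AddCommGroup M] {N : Type*} [AddCommGroup N]

/-- In a group of exponent `2` with four elements, `0, a, b, a + b` (for `a ≠ b` non-zero) are ALL the
elements. [folklore] -/
theorem klein_cases (h4 : Nat.card M = 4) (h2 : ∀ m : M, m + m = 0) {a b : M} (ha : a ≠ 0)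
    (hb : b ≠ 0) (hab : a ≠ b) (m : M) : m = 0 ∨ m = a ∨ m = b ∨ m = a + b := by
  haveI : Finite M := Nat.finite_of_card_ne_zero (by rw [h4]; norm_num)
  haveI : Fintype M := Fintype.ofFinite M
  have hnegb : -b = b := by rw [neg_eq_iff_add_eq_zero, h2]
  have hab0 : a + b ≠ 0 := fun h ↦ hab (by rw [add_eq_zero_iff_eq_neg, hnegb] at h; exact h)
  have haba : a + b ≠ a := fun h ↦ hb (by simpa using h)
  have habb : a + b ≠ b := fun h ↦ ha (by simpa using h)
  set s : Finset M := {0, a, b, a + b} with hs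
  have hcard : s.card = 4 := by
    rw [hs, Finset.card_insert_of_notMem, Finset.card_insert_of_notMem, Finset.card_insert_of_notMem,
      Finset.card_singleton]
    · simp [habb.symm]
    · simp [hab, haba.symm]
    · simp [ha.symm, hb.symm, hab0.symm]
  have huniv : s = Finset.univ := by
    apply Finset.eq_univ_of_card
    rw [hcard, ← Nat.card_eq_fintype_card, h4]
  have hm : m ∈ s := by rw [huniv]; exact Finset.mem_univ m
  simpa [hs, or_assoc] using hm

/-- Two additive maps on a Klein four-group agreeing on the generators `a, b` agree. [folklore] -/
theorem klein_addMonoidHom_ext (h4 : Nat.card M = 4) (h2 : ∀ m : M, m + m = 0) {a b : M}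
    (ha : a ≠ 0) (hb : b ≠ 0) (hab : a ≠ b) {f g : M →+ N} (hfa : f a = g a) (hfb : f b = g b) :
    f = g := by
  refine AddMonoidHom.ext fun m ↦ ?_
  rcases klein_cases h4 h2 ha hb hab m with rfl | rfl | rfl | rfl
  · rw [map_zero, map_zero]
  · exact hfa
  · exact hfb
  · rw [map_add, map_add, hfa, hfb]

/-- **Isomorphisms of Klein four-groups with prescribed values**: for `a ≠ b` non-zero in `M` and
`a' ≠ b'` non-zero in `N` (both groups of exponent `2` with four elements) there is `θ : M ≃+ N` with
`θ a = a'` and `θ b = b'` (hence `θ (a + b) = a' + b'`). [folklore] -/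
theorem klein_exists_addEquiv (h4 : Nat.card M = 4) (h2 : ∀ m : M, m + m = 0)
    (h4' : Nat.card N = 4) (h2' : ∀ n : N, n + n = 0) {a b : M} (ha : a ≠ 0) (hb : b ≠ 0)
    (hab : a ≠ b) {a' b' : N} (ha' : a' ≠ 0) (hb' : b' ≠ 0) (hab' : a' ≠ b') :
    ∃ θ : M ≃+ N, θ a = a' ∧ θ b = b' := by
  haveI : Finite M := Nat.finite_of_card_ne_zero (by rw [h4]; norm_num)
  haveI : Finite N := Nat.finite_of_card_ne_zero (by rw [h4']; norm_num)
  -- relations in `M` and `N`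
  have hnegb : -b = b := by rw [neg_eq_iff_add_eq_zero, h2]
  have hab0 : a + b ≠ 0 := fun h ↦ hab (by rw [add_eq_zero_iff_eq_neg, hnegb] at h; exact h)
  have haba : a + b ≠ a := fun h ↦ hb (by simpa using h)
  have habb : a + b ≠ b := fun h ↦ ha (by simpa using h)
  have hnegb' : -b' = b' := by rw [neg_eq_iff_add_eq_zero, h2']
  have hab0' : a' + b' ≠ 0 := fun h ↦ hab' (by rw [add_eq_zero_iff_eq_neg, hnegb'] at h; exact h)
  -- the map
  set f : M → N := fun m ↦ if m = 0 then 0 else if m = a then a' else if m = b then b' else a' + b'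
    with hf
  have hf0 : f 0 = 0 := by simp [hf]
  have hfa : f a = a' := by simp [hf, ha]
  have hfb : f b = b' := by simp [hf, hb, hab.symm]
  have hfab : f (a + b) = a' + b' := by simp [hf, hab0, haba, habb]
  -- sums in `M` and `N`
  have hM1 : a + a = 0 := h2 a
  have hM2 : b + b = 0 := h2 b
  have hM3 : a + (a + b) = b := by rw [← add_assoc, hM1, zero_add]
  have hM4 : b + (a + b) = a := by rw [add_comm a b, ← add_assoc, hM2, zero_add]
  have hM5 : (a + b) + a = b := by rw [add_comm, hM3]
  have hM6 : (a + b) + b = a := by rw [add_comm, hM4]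
  have hM7 : (a + b) + (a + b) = 0 := h2 _
  have hM8 : b + a = a + b := add_comm b a
  have hN1 : a' + a' = 0 := h2' a'
  have hN2 : b' + b' = 0 := h2' b'
  have hN3 : a' + (a' + b') = b' := by rw [← add_assoc, hN1, zero_add]
  have hN4 : b' + (a' + b') = a' := by rw [add_comm a' b', ← add_assoc, hN2, zero_add]
  have hN5 : (a' + b') + a' = b' := by rw [add_comm, hN3]
  have hN6 : (a' + b') + b' = a' := by rw [add_comm, hN4]
  have hN7 : (a' + b') + (a' + b') = 0 := h2' _
  have hN8 : b' + a' = a' + b' := add_comm b' a'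
  have hadd : ∀ m₁ m₂ : M, f (m₁ + m₂) = f m₁ + f m₂ := by
    intro m₁ m₂
    rcases klein_cases h4 h2 ha hb hab m₁ with rfl | rfl | rfl | rfl <;>
      rcases klein_cases h4 h2 ha hb hab m₂ with rfl | rfl | rfl | rfl <;>
      simp only [zero_add, add_zero, hM1, hM2, hM3, hM4, hM5, hM6, hM7, hM8, hf0, hfa, hfb, hfab,
        hN1, hN2, hN3, hN4, hN5, hN6, hN7, hN8]
  set F : M →+ N := { toFun := f, map_zero' := hf0, map_add' := hadd } with hF
  have hFinj : Function.Injective F := by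
    rw [injective_iff_map_eq_zero]
    intro m hm
    change f m = 0 at hm
    rcases klein_cases h4 h2 ha hb hab m with rfl | rfl | rfl | rfl
    · rfl
    · rw [hfa] at hm; exact absurd hm ha'
    · rw [hfb] at hm; exact absurd hm hb'
    · rw [hfab] at hm; exact absurd hm hab0'
  have hFbij : Function.Bijective F :=
    hFinj.bijective_of_nat_card_le (by rw [h4, h4'])
  exact ⟨AddEquiv.ofBijective F hFbij, hfa, hfb⟩

end Klein

/-! ## §2. The rational point of order `2` inside `E[2](ℚ̄)` -/

section RationalPoint

variable (W : WeierstrassCurve ℚ) [W.IsElliptic]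

/-- `E[2](ℚ̄)` has four elements (`#E[2] = 2²`, Silverman III.6.4(b), tree
`card_torsionPoints_eq_sq_holds`). [cite: SilvermanAEC2009, Cor. III.6.4(b)] -/
theorem natCard_geomTorsion_two : Nat.card (W.geomTorsion 2) = 4 :=
  WeierstrassCurve.card_torsionPoints_eq_sq_holds W (AlgebraicClosure ℚ) (n := 2) (by norm_num)

omit [W.IsElliptic] in
/-- Elements of `E[2](ℚ̄)` have order dividing `2`. [folklore] -/
theorem add_self_geomTorsion_two (T : W.geomTorsion 2) : T + T = 0 := by
  have h : (T : W.geomPoints) ∈ W.geomTorsion 2 := T.2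
  rw [WeierstrassCurve.mem_geomTorsion_iff, two_zsmul] at h
  exact Subtype.ext h

omit [W.IsElliptic] in
/-- The Galois action on an affine geometric point acts on the coordinates. [folklore] -/
theorem smul_geomPoints_of_eq_some (σ : absoluteGaloisGroup ℚ) {X Y : AlgebraicClosure ℚ}
    {h : (W.baseChange (AlgebraicClosure ℚ)).toAffine.Nonsingular X Y} {P : W.geomPoints}
    (hP : P = .some X Y h) : ∃ h', σ • P = .some (σ • X) (σ • Y) h' := by
  subst hP; exact ⟨_, rfl⟩

omit [W.IsElliptic] in
/-- Two affine points with the same coordinates are equal. [folklore] -/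
theorem some_eq_some_geomPoints {X₁ Y₁ X₂ Y₂ : AlgebraicClosure ℚ}
    {h₁ : (W.baseChange (AlgebraicClosure ℚ)).toAffine.Nonsingular X₁ Y₁}
    {h₂ : (W.baseChange (AlgebraicClosure ℚ)).toAffine.Nonsingular X₂ Y₂} (hX : X₁ = X₂)
    (hY : Y₁ = Y₂) :
    (WeierstrassCurve.Affine.Point.some X₁ Y₁ h₁ : (W.baseChange (AlgebraicClosure ℚ)).toAffine.Point) =
      .some X₂ Y₂ h₂ := by
  subst hX; subst hY; rfl

omit [W.IsElliptic] in
/-- A geometric affine point `(X, Y)` with `2Y + a₁X + a₃ = 0` has order `2`. [cite: SilvermanAEC2009, III.2.3] -/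
theorem add_self_eq_zero_geomPoints_of_eq_some {X Y : AlgebraicClosure ℚ}
    {h : (W.baseChange (AlgebraicClosure ℚ)).toAffine.Nonsingular X Y} {P : W.geomPoints}
    (hP : P = .some X Y h)
    (h2 : 2 * Y + (W.a₁ : AlgebraicClosure ℚ) * X + (W.a₃ : AlgebraicClosure ℚ) = 0) :
    P + P = 0 := by
  subst hP
  have ha₁ : (W.baseChange (AlgebraicClosure ℚ)).toAffine.a₁ = (W.a₁ : AlgebraicClosure ℚ) := by
    simp only [WeierstrassCurve.baseChange, WeierstrassCurve.map_a₁, eq_ratCast]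
  have ha₃ : (W.baseChange (AlgebraicClosure ℚ)).toAffine.a₃ = (W.a₃ : AlgebraicClosure ℚ) := by
    simp only [WeierstrassCurve.baseChange, WeierstrassCurve.map_a₃, eq_ratCast]
  have hneg : Y = (W.baseChange (AlgebraicClosure ℚ)).toAffine.negY X Y := by
    rw [WeierstrassCurve.Affine.negY, ha₁, ha₃]
    linear_combination h2
  exact WeierstrassCurve.Affine.Point.add_of_Y_eq rfl hneg

omit [W.IsElliptic] in
/-- Conversely an affine geometric point of order dividing `2` has `2Y + a₁X + a₃ = 0` and `X` a root
of the `2`-division cubic (tree `isRoot_twoTorsionPolynomial_of_add_self_eq_zero` over `ℚ̄`).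
[cite: SilvermanAEC2009, III.2.3 and Ex. 3.7] -/
theorem two_torsion_coords_geomPoints {X Y : AlgebraicClosure ℚ}
    {h : (W.baseChange (AlgebraicClosure ℚ)).toAffine.Nonsingular X Y} {P : W.geomPoints}
    (hP : P = .some X Y h) (h2 : P + P = 0) :
    2 * Y + (W.a₁ : AlgebraicClosure ℚ) * X + (W.a₃ : AlgebraicClosure ℚ) = 0 ∧
      4 * X ^ 3 + (W.b₂ : AlgebraicClosure ℚ) * X ^ 2 + 2 * (W.b₄ : AlgebraicClosure ℚ) * X +
        (W.b₆ : AlgebraicClosure ℚ) = 0 := by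
  subst hP
  obtain ⟨hY, hr⟩ :=
    (W.baseChange (AlgebraicClosure ℚ)).toAffine.isRoot_twoTorsionPolynomial_of_add_self_eq_zero h2
  have ha₁ : (W.baseChange (AlgebraicClosure ℚ)).toAffine.a₁ = (W.a₁ : AlgebraicClosure ℚ) := by
    simp only [WeierstrassCurve.baseChange, WeierstrassCurve.map_a₁, eq_ratCast]
  have ha₃ : (W.baseChange (AlgebraicClosure ℚ)).toAffine.a₃ = (W.a₃ : AlgebraicClosure ℚ) := by
    simp only [WeierstrassCurve.baseChange, WeierstrassCurve.map_a₃, eq_ratCast]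
  have hb₂ : (W.baseChange (AlgebraicClosure ℚ)).toAffine.b₂ = (W.b₂ : AlgebraicClosure ℚ) := by
    simp only [WeierstrassCurve.baseChange, WeierstrassCurve.map_b₂, eq_ratCast]
  have hb₄ : (W.baseChange (AlgebraicClosure ℚ)).toAffine.b₄ = (W.b₄ : AlgebraicClosure ℚ) := by
    simp only [WeierstrassCurve.baseChange, WeierstrassCurve.map_b₄, eq_ratCast]
  have hb₆ : (W.baseChange (AlgebraicClosure ℚ)).toAffine.b₆ = (W.b₆ : AlgebraicClosure ℚ) := by
    simp only [WeierstrassCurve.baseChange, WeierstrassCurve.map_b₆, eq_ratCast]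
  constructor
  · rw [WeierstrassCurve.Affine.negY, ha₁, ha₃] at hY
    linear_combination hY
  · simp only [WeierstrassCurve.twoTorsionPolynomial, Cubic.toPoly, Polynomial.IsRoot.def,
      Polynomial.eval_add, Polynomial.eval_mul, Polynomial.eval_C, Polynomial.eval_pow,
      Polynomial.eval_X, hb₂, hb₄, hb₆] at hr
    linear_combination hr

/-- **The rational point of order `2` as an element of `E[2](ℚ̄)`.** From `HasRationalTwoTorsionX W x`
(a rational affine point `(x, y)` with `2y + a₁x + a₃ = 0`): a NON-ZERO, `Γ_ℚ`-FIXED element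
`P ∈ E[2](ℚ̄)` with coordinates `(x, y)`. [cite: GreenbergLNM1716, Prop. 5.14 (the point `P`)]
[cite: SilvermanAEC2009, III.2.3 and VIII.1] -/
theorem exists_geomTorsion_two_of_hasRationalTwoTorsionX {x : ℚ} (hx : HasRationalTwoTorsionX W x) :
    ∃ (y : ℚ) (h : (W.baseChange (AlgebraicClosure ℚ)).toAffine.Nonsingular
        (x : AlgebraicClosure ℚ) (y : AlgebraicClosure ℚ)) (P : W.geomTorsion 2),
      (P : W.geomPoints) = .some _ _ h ∧ P ≠ 0 ∧ (∀ σ : absoluteGaloisGroup ℚ, σ • P = P) ∧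
        2 * y + W.a₁ * x + W.a₃ = 0 := by
  obtain ⟨y, hxy, h2⟩ := hx
  have hxy' : (W.baseChange (AlgebraicClosure ℚ)).toAffine.Equation
      (x : AlgebraicClosure ℚ) (y : AlgebraicClosure ℚ) := by
    have h := WeierstrassCurve.Affine.Equation.map (algebraMap ℚ (AlgebraicClosure ℚ)) hxy
    simp only [eq_ratCast] at h
    exact h
  have h : (W.baseChange (AlgebraicClosure ℚ)).toAffine.Nonsingular
      (x : AlgebraicClosure ℚ) (y : AlgebraicClosure ℚ) :=
    (WeierstrassCurve.Affine.equation_iff_nonsingular).mp hxy'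
  have h2' : 2 * (y : AlgebraicClosure ℚ) + (W.a₁ : AlgebraicClosure ℚ) * (x : AlgebraicClosure ℚ) +
      (W.a₃ : AlgebraicClosure ℚ) = 0 := by
    have := congrArg (fun q : ℚ ↦ (q : AlgebraicClosure ℚ)) h2
    push_cast at this
    simpa using this
  set P₀ : W.geomPoints := .some _ _ h with hP₀
  have hmem : P₀ ∈ W.geomTorsion 2 := by
    rw [WeierstrassCurve.mem_geomTorsion_iff, two_zsmul]
    exact add_self_eq_zero_geomPoints_of_eq_some W hP₀ h2'
  refine ⟨y, h, ⟨P₀, hmem⟩, rfl, ?_, ?_, h2⟩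
  · intro h0
    exact WeierstrassCurve.Affine.Point.some_ne_zero h (congrArg Subtype.val h0)
  · intro σ
    apply Subtype.ext
    rw [AddSubgroup.torsionBy.coe_smul]
    obtain ⟨h', e⟩ := smul_geomPoints_of_eq_some W σ hP₀
    change σ • P₀ = P₀
    rw [e, hP₀]
    exact some_eq_some_geomPoints W (by rw [Field.absoluteGaloisGroup.smul_def, map_ratCast])
      (by rw [Field.absoluteGaloisGroup.smul_def, map_ratCast])

/-- **Uniqueness**: if `(x, ·)` is the ONLY rational point of order `2` (`HasUniqueRationalTwoTorsionX`),
then every `Γ_ℚ`-fixed `T ∈ E[2](ℚ̄)` is `0` or the point `P` of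
`exists_geomTorsion_two_of_hasRationalTwoTorsionX`: a fixed `T` descends to a rational point
(`exists_toGeomPoints_eq_of_forall_smul_eq`), of order `2`, hence with abscissa `x`, and a point of
order `2` is determined by its abscissa. [cite: GreenbergLNM1716, Prop. 5.14] [cite: SilvermanAEC2009, VIII.1] -/
theorem eq_zero_or_eq_of_smul_eq {x y : ℚ} (hx : HasUniqueRationalTwoTorsionX W x)
    (h : (W.baseChange (AlgebraicClosure ℚ)).toAffine.Nonsingular
        (x : AlgebraicClosure ℚ) (y : AlgebraicClosure ℚ))
    (h2 : 2 * y + W.a₁ * x + W.a₃ = 0)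
    {P : W.geomTorsion 2} (hP : (P : W.geomPoints) = .some _ _ h)
    {T : W.geomTorsion 2} (hT : ∀ σ : absoluteGaloisGroup ℚ, σ • T = T) : T = 0 ∨ T = P := by
  have hT' : ∀ σ : absoluteGaloisGroup ℚ, σ • (T : W.geomPoints) = T := fun σ ↦ by
    rw [← AddSubgroup.torsionBy.coe_smul, hT σ]
  obtain ⟨T₀, hT₀⟩ := exists_toGeomPoints_eq_of_forall_smul_eq W hT'
  have hT2 : (T : W.geomPoints) + T = 0 := by
    rw [← two_zsmul]; exact (WeierstrassCurve.mem_geomTorsion_iff W 2 _).mp T.2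
  rcases T₀ with _ | ⟨e, f, hef⟩
  · left
    exact Subtype.ext (by rw [← hT₀]; rfl)
  · right
    -- `T = (e, f)` read in `ℚ̄`
    have hef' : (W.baseChange (AlgebraicClosure ℚ)).toAffine.Nonsingular
        (e : AlgebraicClosure ℚ) (f : AlgebraicClosure ℚ) := by
      have h := WeierstrassCurve.Affine.Equation.map (algebraMap ℚ (AlgebraicClosure ℚ))
        ((WeierstrassCurve.Affine.equation_iff_nonsingular).mpr hef)
      simp only [eq_ratCast] at h
      exact (WeierstrassCurve.Affine.equation_iff_nonsingular).mp h
    have hTe : (T : W.geomPoints) = .some (e : AlgebraicClosure ℚ) (f : AlgebraicClosure ℚ) hef' := by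
      rw [← hT₀]
      exact some_eq_some_geomPoints W (X₁ := algebraMap ℚ (AlgebraicClosure ℚ) e)
        (Y₁ := algebraMap ℚ (AlgebraicClosure ℚ) f)
        (h₁ := (WeierstrassCurve.Affine.baseChange_nonsingular (W := W.toAffine)
          (Algebra.ofId ℚ (AlgebraicClosure ℚ)).injective ..).mpr hef)
        (eq_ratCast _ e) (eq_ratCast _ f)
    obtain ⟨hfe, -⟩ := two_torsion_coords_geomPoints W hTe hT2
    have hfe' : 2 * f + W.a₁ * e + W.a₃ = 0 := by
      have h' : ((2 * f + W.a₁ * e + W.a₃ : ℚ) : AlgebraicClosure ℚ) = 0 := by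
        push_cast; exact hfe
      exact_mod_cast h'
    have he : e = x := hx.2 e ⟨f, (WeierstrassCurve.Affine.equation_iff_nonsingular).mpr hef, hfe'⟩
    subst he
    have hfy : f = y := by linear_combination (1 / 2 : ℚ) * (hfe' - h2)
    subst hfy
    exact Subtype.ext (by rw [hP, hTe])

/-- **Dévissage of `E[2](ℚ̄)` along the rational point**: for every `σ ∈ Γ_ℚ` and `T ∈ E[2](ℚ̄)`,
`σ • T = T` or `σ • T = T + P` (tree `sub_mem_pair_of_natCard_le_four`: `Γ_ℚ` fixes `P` and permutes
the four points). [cite: SilvermanAEC2009, X.4 Ex. 4.8–Prop. 4.9] -/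
theorem smul_eq_self_or_eq_add {P : W.geomTorsion 2} (hP0 : P ≠ 0)
    (hPσ : ∀ σ : absoluteGaloisGroup ℚ, σ • P = P) (σ : absoluteGaloisGroup ℚ) (T : W.geomTorsion 2) :
    σ • T = T ∨ σ • T = T + P := by
  haveI : Finite (W.geomTorsion 2) :=
    Nat.finite_of_card_ne_zero (by rw [natCard_geomTorsion_two W]; norm_num)
  set f : W.geomTorsion 2 →+ W.geomTorsion 2 := DistribSMul.toAddMonoidHom (W.geomTorsion 2) σ
    with hf
  have hfinj : Function.Injective f := fun a b h ↦ by
    change σ • a = σ • b at h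
    simpa using congrArg (fun t ↦ σ⁻¹ • t) h
  rcases sub_mem_pair_of_natCard_le_four (natCard_geomTorsion_two W).le (add_self_geomTorsion_two W)
    hP0 f hfinj (hPσ σ) T with h | h
  · left; exact sub_eq_zero.mp h
  · right
    change σ • T - T = P at h
    rw [← h]; abel

end RationalPoint

end Summit.BirchSwinnertonDyer.BirchSwinnertonDyer.Theorems.MultTransportAtTwo

end
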